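import Summits.KontsevichZagierPeriods.Zeta5Search.WellPoisedFaceTailLinearForms
import Summits.KontsevichZagierPeriods.Zeta5Search.WellPoisedFaceOddGrowth
import HarnessLib

/-!
# Odd-zeta search — the face forms with `B` tail bricks are linear forms in `1, ζ(5), ζ(7), …, ζ(B+1)`,
# part 3: denominators and the theorems — the ODD WINDOW of the numerator-free face (cell `pub-zeta5`, fam-odd gen 9)

HONEST FRAMING: systematic search; no irrationality claim unless certified.

Conclusion of `WellPoisedFaceTailLinearFormsPF` / `WellPoisedFaceTailLinearForms` (fam-odd gen 9; overview in the
former).  For Zudilin's face form `F(h_n) = ½ Σ_{t≥0} R″(t)` (`tailF η₀ η n`, gen 8's `WellPoisedFaceTailRate`) with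
`B ≥ 3` tail bricks `η : Fin B → ℕ` on an integral face direction (`2η_j < η₀`), `D = D_{η₀n} = lcm(1, …, η₀n)`:

* §T6 `D^{B−1−o} A_o ∈ ℤ`, `D^{B+2} A₀ ∈ ℤ` (`tailCoef_den`, `tailConst_den`); `tailF_linearForm` (any `B ≥ 3`:
  `F = Σ_{o<B} A_o ζ(o+3) − A₀`, the `ζ(3)`-coefficient and every `A_o` with `B(η₀n+1)+o` odd vanish);
  **`tailF_linearForm_odd`** (EVEN `B`: `F_n = Σ_{s odd, 5 ≤ s ≤ B+1} A_s ζ(s) − A₀`, `D^{B+2−s} A_s ∈ ℤ`,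
  `D^{B+2} A₀ ∈ ℤ` — no `ζ(3)`, no even zeta value); `tailF_mem_odd` (`D^{B+2} F_n ∈ ℤ + Σ_{s odd} ℤζ(s)`);
* §T7 the integral face directions `E : IntFaceDir M` of fam-odd 5 (`WellPoisedFaceOddGrowth`; `q = M + 5`,
  `B = M + 2`; `tailF E.η₀ E.tail` is gen 8's `IntFaceDir.faceForm E` by `rfl`): for `M ≥ 1` even,
  `IntFaceDir.tailF_linearForm_odd` and `IntFaceDir.faceLambda_tailF_mem_ratSpan` — the normalised face forms
  `Λ_n = D·Φ⁻¹·F_n`, which GROW by gen 8's hypothesis-free `faceLambda_faceForm_tendsto_atTop` (`M ≤ 6`), lie in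
  `ℚ + ℚζ(5) + ℚζ(7) + … + ℚζ(M+3)`; kernel instances `q = 9` (window `{ζ5, ζ7}`: the symmetric direction
  `(3; 0³, 1⁶)` and the MODEL direction `modelFace9Int`) and `q = 11` (`{ζ5, ζ7, ζ9}`).

Together with gen 8 this makes the odd-window FACE theorem of the cell hypothesis-free in BOTH halves for
`q = 9, 11` (as fam-vwp gen 7 did for `q = 7`): on every integral direction of the numerator-free face the forms are
linear forms in `1` and the window's odd zeta values with controlled denominators, AND their integer normalisations
grow — so they prove nothing about `ζ(5)`, `ζ(7)`, `ζ(9)`.  [Zudilin2004, Lemma 19] has the sharper denominator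
`Π_j D_{M_j}` and the `Φ⁻¹` saving (printed, not formalised); the conclusion is the same.  Standard axioms only.
-/

noncomputable section

open Finset Filter Topology

namespace Summit.KontsevichZagierPeriods.Zeta5Search.WellPoisedFaceRate

open Literature.NumberTheory.Transcendental (zetaValue)
open Literature.NumberTheory.Transcendental.BallRivoal (IsInt harm isInt_dpow_mul_harm)
open Summit.KontsevichZagierPeriods.Zeta5Search.DualSeriesDenominators (natCast_dvd_lcmUpto)

variable {B : ℕ} (η₀ : ℕ) (η : Fin B → ℕ) (n : ℕ)

/-! ## T6. Denominators and the theorems -/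

/-- The triangular factor is an integer: `(o+1)(o+2)/2 ∈ ℤ`. -/
theorem tri_int (o : ℕ) : ∃ z : ℤ, ((o : ℚ) + 1) * ((o : ℚ) + 2) / 2 = z := by
  obtain ⟨r, hr⟩ := Nat.even_mul_succ_self (o + 1)
  refine ⟨r, ?_⟩
  have h : ((o : ℚ) + 1) * ((o : ℚ) + 2) = (r : ℚ) + r := by
    have := congrArg (fun m : ℕ => (m : ℚ)) hr
    push_cast at this
    linear_combination this
  rw [h]
  push_cast
  ring

/-- `d^{K−1−o}·A_o ∈ ℤ` for data with `d^{K−1−o} c_{o,p} ∈ ℤ`. -/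
theorem tailCoef_den (N K d : ℕ) (c : ℕ → ℕ → ℚ) (hint : IsInt K d c) (o : ℕ) :
    ∃ z : ℤ, (d : ℚ) ^ (K - 1 - o) * tailCoef N c o = z := by
  obtain ⟨m, hm⟩ := tri_int o
  have h : ∀ p ∈ range (N + 1), ∃ z : ℤ, (m : ℚ) * ((d : ℚ) ^ (K - 1 - o) * c o p) = z := by
    intro p _
    obtain ⟨z, hz⟩ := hint o p
    exact ⟨m * z, by rw [hz]; push_cast; ring⟩
  obtain ⟨z, hz⟩ := exists_int_sum _ _ h
  refine ⟨z, ?_⟩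
  rw [← hz, tailCoef, hm]
  simp only [mul_sum]
  exact sum_congr rfl fun p _ => by ring

/-- `d^{K+2}·A₀ ∈ ℤ` for data with `d^{K−1−o} c_{o,p} ∈ ℤ` and `d` a common multiple of `1, …, N`
(`d^{K−1−o} c_{o,p} · d^{o+3} H_p^{(o+3)}`). -/
theorem tailConst_den (N K d : ℕ) (hdiv : ∀ k : ℕ, 1 ≤ k → k ≤ N → (k : ℤ) ∣ d) (c : ℕ → ℕ → ℚ)
    (hint : IsInt K d c) : ∃ z : ℤ, (d : ℚ) ^ (K + 2) * tailConst N K c = z := by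
  have h : ∀ p ∈ range (N + 1), ∃ z : ℤ, (d : ℚ) ^ (K + 2) *
      ∑ o ∈ range K, ((o : ℚ) + 1) * ((o : ℚ) + 2) / 2 * (c o p * harm (o + 3) p) = z := by
    intro p hp
    have hp' : p ≤ N := by have := mem_range.1 hp; omega
    have h' : ∀ o ∈ range K, ∃ z : ℤ,
        (d : ℚ) ^ (K + 2) * (((o : ℚ) + 1) * ((o : ℚ) + 2) / 2 * (c o p * harm (o + 3) p)) = z := by
      intro o ho
      have ho' := mem_range.1 ho
      obtain ⟨m, hm⟩ := tri_int o
      obtain ⟨z, hz⟩ := hint o p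
      obtain ⟨w, hw⟩ := isInt_dpow_mul_harm N d hdiv (o + 3) p hp'
      refine ⟨m * z * w, ?_⟩
      rw [show K + 2 = (K - 1 - o) + (o + 3) by omega, pow_add, hm]
      push_cast
      rw [← hz, ← hw]
      ring
    obtain ⟨z, hz⟩ := exists_int_sum _ _ h'
    exact ⟨z, by rw [← hz, mul_sum]⟩
  obtain ⟨z, hz⟩ := exists_int_sum _ _ h
  exact ⟨z, by rw [← hz, tailConst, mul_sum]⟩

/-- **THEOREM (linear forms, any `B ≥ 3`).**  On every integral face direction with `B ≥ 3` tail bricks and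
every `n`, Zudilin's form `F(h_n) = ½ Σ_{t≥0} R″(t)` (file A's `tailF`) is `Σ_{o<B} A_o ζ(o+3) − A₀` over `ℚ`
with the data's coefficients `A_o = tailCoef`, `A₀ = tailConst` (`D^{B−1−o}A_o`, `D^{B+2}A₀ ∈ ℤ` by
`tailCoef_den`, `tailConst_den`), where the `ζ(3)`-coefficient VANISHES and so does every `A_o` with
`B(η₀n+1) + o` odd (even `B`: all even zeta values; odd `B`, even `η₀n`: all odd ones). -/
theorem tailF_linearForm (hB : 3 ≤ B) (hη : ∀ j, 2 * η j < η₀) :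
    ∃ c : ℕ → ℕ → ℚ, IsInt B (Nat.lcmUpto (η₀ * n)) c ∧
      tailF η₀ η n = (∑ o ∈ range B, (tailCoef (η₀ * n) c o : ℝ) * zetaValue (o + 3))
          - (tailConst (η₀ * n) B c : ℝ) ∧
      tailCoef (η₀ * n) c 0 = 0 ∧
      (∀ o, o < B → Odd (B * (η₀ * n + 1) + o) → tailCoef (η₀ * n) c o = 0) := by
  obtain ⟨c, hint, C, hc⟩ := exists_tailData η₀ η n (le_trans (by norm_num) hB) hη
  refine ⟨c, hint, tailF_eq_coef hB hη hc, ?_, fun o ho hodd => ?_⟩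
  · rw [tailCoef, tail_sum_order_zero hB hη hc, mul_zero]
  · rw [tailCoef, tail_sum_vanish hB hη hc o ho hodd, mul_zero]

/-- **THEOREM (the odd window).**  For an EVEN number `B ≥ 3` of tail bricks (the boxes `q = B + 3 = 7, 9, 11, …`),
on every integral face direction (`2η_j < η₀`) and every `n`:
`F(h_n) = Σ_{s odd, 5 ≤ s ≤ B+1} A_s ζ(s) − A₀` with `A_s, A₀ ∈ ℚ`, `D_{η₀n}^{B+2−s} A_s ∈ ℤ`, `D_{η₀n}^{B+2} A₀ ∈ ℤ`
— a linear form in `1` and the ODD zeta values `ζ(5), …, ζ(B+1)` ALONE (no `ζ(3)`, no even zeta value).  The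
index set is written `(Ioc 3 (B+2)).filter Odd = {5, 7, …, B+1}`.  [Zudilin2004, Lemma 19] (sharper denominator,
printed). -/
theorem tailF_linearForm_odd (hB : 3 ≤ B) (hBe : Even B) (hη : ∀ j, 2 * η j < η₀) :
    ∃ A : ℕ → ℚ, ∃ A₀ : ℚ,
      tailF η₀ η n = (∑ s ∈ (Ioc 3 (B + 2)).filter Odd, (A s : ℝ) * zetaValue s) - (A₀ : ℝ) ∧
      (∀ s, ∃ z : ℤ, (Nat.lcmUpto (η₀ * n) : ℚ) ^ (B + 2 - s) * A s = z) ∧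
      (∃ z : ℤ, (Nat.lcmUpto (η₀ * n) : ℚ) ^ (B + 2) * A₀ = z) := by
  obtain ⟨c, hint, hF, h0, hpar⟩ := tailF_linearForm η₀ η n hB hη
  refine ⟨fun s => tailCoef (η₀ * n) c (s - 3), tailConst (η₀ * n) B c, ?_, fun s => ?_,
    tailConst_den _ _ _ (fun k hk1 hk2 => natCast_dvd_lcmUpto hk1 hk2) c hint⟩
  · have hre : ∑ s ∈ Ico 3 (B + 3), (tailCoef (η₀ * n) c (s - 3) : ℝ) * zetaValue s
        = ∑ o ∈ range B, (tailCoef (η₀ * n) c o : ℝ) * zetaValue (o + 3) := by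
      rw [Finset.sum_Ico_eq_sum_range, Nat.add_sub_cancel]
      refine sum_congr rfl fun o _ => ?_
      rw [Nat.add_sub_cancel_left, add_comm 3 o]
    have hsub : (Ioc 3 (B + 2)).filter Odd ⊆ Ico 3 (B + 3) := by
      intro x hx
      rw [mem_filter, mem_Ioc] at hx
      rw [mem_Ico]
      omega
    have hvan : ∀ x ∈ Ico 3 (B + 3), x ∉ (Ioc 3 (B + 2)).filter Odd →
        (tailCoef (η₀ * n) c (x - 3) : ℝ) * zetaValue x = 0 := by
      intro x hx hx'
      rw [mem_Ico] at hx
      rw [mem_filter, mem_Ioc] at hx'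
      by_cases h3 : x = 3
      · subst h3
        rw [Nat.sub_self, h0, Rat.cast_zero, zero_mul]
      · have hev : ¬Odd x := fun hodd => hx' ⟨⟨by omega, by omega⟩, hodd⟩
        have hodd : Odd (B * (η₀ * n + 1) + (x - 3)) := by
          refine (hBe.mul_right _).add_odd ?_
          rw [Nat.not_odd_iff_even, Nat.even_iff] at hev
          rw [Nat.odd_iff]
          omega
        rw [hpar (x - 3) (by omega) hodd, Rat.cast_zero, zero_mul]
    beta_reduce
    rw [hF, ← hre, Finset.sum_subset hsub hvan]
  · beta_reduce
    by_cases hs : s ≤ 3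
    · refine ⟨0, ?_⟩
      rw [show s - 3 = 0 by omega, h0, mul_zero, Int.cast_zero]
    · rw [show B + 2 - s = B - 1 - (s - 3) by omega]
      exact tailCoef_den _ _ _ c hint (s - 3)

/-- **COROLLARY.** `D_{η₀n}^{B+2} · F(h_n) ∈ ℤ + Σ_{s odd, 5≤s≤B+1} ℤ·ζ(s)` (even `B ≥ 3`, every integral face
direction, every `n`). -/
theorem tailF_mem_odd (hB : 3 ≤ B) (hBe : Even B) (hη : ∀ j, 2 * η j < η₀) :
    ∃ a : ℕ → ℤ, ∃ b : ℤ, ((Nat.lcmUpto (η₀ * n) : ℝ)) ^ (B + 2) * tailF η₀ η n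
      = (∑ s ∈ (Ioc 3 (B + 2)).filter Odd, (a s : ℝ) * zetaValue s) - (b : ℝ) := by
  obtain ⟨A, A₀, hF, hA, ⟨zb, hzb⟩⟩ := tailF_linearForm_odd η₀ η n hB hBe hη
  choose za hza using hA
  refine ⟨fun s => (Nat.lcmUpto (η₀ * n) : ℤ) ^ s * za s, zb, ?_⟩
  have eb : ((Nat.lcmUpto (η₀ * n) : ℝ)) ^ (B + 2) * (A₀ : ℝ) = (zb : ℝ) := by
    have := congrArg (fun q : ℚ => (q : ℝ)) hzb
    push_cast at this
    exact this
  beta_reduce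
  rw [hF, mul_sub, eb, mul_sum]
  congr 1
  refine sum_congr rfl fun s hs => ?_
  have hs' : s ≤ B + 2 := by
    rw [mem_filter, mem_Ioc] at hs
    omega
  have ea : ((Nat.lcmUpto (η₀ * n) : ℝ)) ^ (B + 2 - s) * (A s : ℝ) = (za s : ℝ) := by
    have := congrArg (fun q : ℚ => (q : ℝ)) (hza s)
    push_cast at this
    exact this
  rw [show ((Nat.lcmUpto (η₀ * n) : ℝ)) ^ (B + 2)
      = ((Nat.lcmUpto (η₀ * n) : ℝ)) ^ s * ((Nat.lcmUpto (η₀ * n) : ℝ)) ^ (B + 2 - s) by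
    rw [← pow_add, Nat.add_sub_cancel' hs']]
  push_cast
  rw [← ea]
  ring

end Summit.KontsevichZagierPeriods.Zeta5Search.WellPoisedFaceRate

/-! ## T7. The integral face directions of fam-odd 5 (`IntFaceDir M`, `q = M + 5`, `B = M + 2`) -/

namespace Summit.KontsevichZagierPeriods.Zeta5Search.WellPoisedFace.IntFaceDir

open Literature.NumberTheory.Transcendental (zetaValue)
open Summit.KontsevichZagierPeriods.Zeta5Search.WellPoisedFaceRate (tailF)

variable {M : ℕ} (E : IntFaceDir M)

/-- **The odd window on an integral face direction** of the `q = M + 5` box, `M ≥ 1` EVEN (`q = 9, 11, …`; `q = 7`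
is fam-vwp's `faceF_linearForm`): Zudilin's face form `F(h_n)` (`= tailF E.η₀ E.tail n`, gen 8's
`IntFaceDir.faceForm E n` by `rfl`) is `Σ_{s odd, 5 ≤ s ≤ M+3} A_s ζ(s) − A₀` with `A_s, A₀ ∈ ℚ`,
`D_{η₀n}^{M+4−s} A_s ∈ ℤ` and `D_{η₀n}^{M+4} A₀ ∈ ℤ`. -/
theorem tailF_linearForm_odd (hM1 : 1 ≤ M) (hM : Even M) (n : ℕ) :
    ∃ A : ℕ → ℚ, ∃ A₀ : ℚ,
      tailF E.η₀ E.tail n = (∑ s ∈ (Ioc 3 (M + 4)).filter Odd, (A s : ℝ) * zetaValue s) - (A₀ : ℝ) ∧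
      (∀ s, ∃ z : ℤ, (Nat.lcmUpto (E.η₀ * n) : ℚ) ^ (M + 4 - s) * A s = z) ∧
      (∃ z : ℤ, (Nat.lcmUpto (E.η₀ * n) : ℚ) ^ (M + 4) * A₀ = z) :=
  WellPoisedFaceRate.tailF_linearForm_odd E.η₀ E.tail n (by omega) (hM.add even_two)
    fun j => lt_of_le_of_lt (Nat.mul_le_mul_left 2 (E.hhi j)) E.hd

/-- **COROLLARY.** The normalised face forms `Λ_n = D·Φ⁻¹·F_n` (`E.faceLambda`, which grow: fam-odd 7 / gen 8's
`faceLambda_faceForm_tendsto_atTop`) lie in `ℚ + ℚζ(5) + ℚζ(7) + … + ℚζ(M+3)` for `M ≥ 1` even (kernel);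
[Zudilin2004, Lemma 19] places them in the `ℤ`-span (printed).  Either way they prove nothing about these numbers. -/
theorem faceLambda_tailF_mem_ratSpan (hM1 : 1 ≤ M) (hM : Even M) (n : ℕ) :
    ∃ u : ℕ → ℚ, ∃ v : ℚ, E.faceLambda (tailF E.η₀ E.tail) n
      = (∑ s ∈ (Ioc 3 (M + 4)).filter Odd, (u s : ℝ) * zetaValue s) - (v : ℝ) := by
  obtain ⟨A, A₀, hF, -, -⟩ := E.tailF_linearForm_odd hM1 hM n
  refine ⟨fun s => (E.faceD n : ℚ) / (E.facePhi n : ℚ) * A s, (E.faceD n : ℚ) / (E.facePhi n : ℚ) * A₀, ?_⟩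
  beta_reduce
  rw [faceLambda, hF, mul_sub, mul_sum]
  push_cast
  congr 1
  exact sum_congr rfl fun s _ => by ring

/-- Kernel instance, `q = 9` (window `{ζ5, ζ7}`): the classical symmetric direction `(3; 0³, 1⁶)` —
`D_{3n}⁸ · F_n = a₅ ζ(5) + a₇ ζ(7) − b` with `a₅, a₇, b ∈ ℤ`, every `n`. -/
example (n : ℕ) : ∃ a : ℕ → ℤ, ∃ b : ℤ,
    ((Nat.lcmUpto (3 * n) : ℝ)) ^ 8 * tailF 3 ![1, 1, 1, 1, 1, 1] n
      = (a 5 : ℝ) * zetaValue 5 + (a 7 : ℝ) * zetaValue 7 - (b : ℝ) := by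
  obtain ⟨a, b, h⟩ := WellPoisedFaceRate.tailF_mem_odd 3 ![1, 1, 1, 1, 1, 1] n (by norm_num) ⟨3, rfl⟩ (by decide)
  refine ⟨a, b, ?_⟩
  rw [h, show (Ioc 3 (6 + 2)).filter Odd = {5, 7} by decide, sum_pair (by norm_num)]

/-- Kernel instance, `q = 11` (window `{ζ5, ζ7, ζ9}`): the symmetric direction `(3; 0³, 1⁸)` —
`D_{3n}¹⁰ · F_n = a₅ ζ(5) + a₇ ζ(7) + a₉ ζ(9) − b`, every `n`. -/
example (n : ℕ) : ∃ a : ℕ → ℤ, ∃ b : ℤ,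
    ((Nat.lcmUpto (3 * n) : ℝ)) ^ 10 * tailF 3 ![1, 1, 1, 1, 1, 1, 1, 1] n
      = (a 5 : ℝ) * zetaValue 5 + (a 7 : ℝ) * zetaValue 7 + (a 9 : ℝ) * zetaValue 9 - (b : ℝ) := by
  obtain ⟨a, b, h⟩ :=
    WellPoisedFaceRate.tailF_mem_odd 3 ![1, 1, 1, 1, 1, 1, 1, 1] n (by norm_num) ⟨4, rfl⟩ (by decide)
  refine ⟨a, b, ?_⟩
  rw [h, show (Ioc 3 (8 + 2)).filter Odd = {5, 7, 9} by decide, sum_insert (by decide), sum_pair (by norm_num)]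
  ring

/-- Kernel instance, `q = 9`: the MODEL integral face direction `modelFace9Int` of fam-odd 5 — its growing forms
`Λ_n` (`faceLambda_faceForm_tendsto_atTop`) lie in `ℚ + ℚζ(5) + ℚζ(7)`. -/
example (n : ℕ) : ∃ u : ℕ → ℚ, ∃ v : ℚ, modelFace9Int.faceLambda (tailF modelFace9Int.η₀ modelFace9Int.tail) n
    = (u 5 : ℝ) * zetaValue 5 + (u 7 : ℝ) * zetaValue 7 - (v : ℝ) := by
  obtain ⟨u, v, h⟩ := modelFace9Int.faceLambda_tailF_mem_ratSpan (by norm_num) ⟨2, rfl⟩ n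
  refine ⟨u, v, ?_⟩
  rw [h, show (Ioc 3 (4 + 4)).filter Odd = {5, 7} by decide, sum_pair (by norm_num)]

end Summit.KontsevichZagierPeriods.Zeta5Search.WellPoisedFace.IntFaceDir
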